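import Summits.HubbardSuperconductivity.HubbardSuperconductivity.Theorems.AnisotropyChordTransferFibre3GreenZeroBoseRows

/-!
# Route `AnisotropyChord` / H0 rotor rung: the Bose (ring-correction) part of the capacity row sum is `≤ 7·10⁻⁴` (family A, LEMMA A0 step 3b)

In the exact row form `G̃₀(0) = (1 − 1/L²)/12 + (1/L)Σ_{p=1}^{L−1}(1 + b_p)ψ₀(2πp/L)` (`…GreenZeroRowForm.Gres_zero_eq`,
`b_p = 2/(e^{Lμ_p} − 1)`, `ψ₀ = psiRow 0`) the ring corrections are exponentially small except for the first rows; with the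
row-rapidity and `ψ₀/L` bounds of `…GreenZeroBoseRows`, the per-row bounds proved here (`bose_term_one ≤ 3.2·10⁻⁴`,
`bose_term_two ≤ 10⁻⁶` for `L ≥ 64`; `bose_term_crude ≤ (1/6)e^{−3.5p}` for `3 ≤ p ≤ L/2`) and the reflection `p ↔ L − p`:
★ `bose_sum_bounds`: **`0 ≤ (1/L)Σ_{p=1}^{L−1} b_p ψ₀(2πp/L) ≤ 0.0007`** for every `L ≥ 64` (truth `→ Σ_m 1/(πm(e^{2πm}−1)) = 5.97·10⁻⁴`).
Prover seat `hubbard-h0-rotor-p1` g26; helper for stmt-HubbardSuperconductivity-19089 (`--supports`, helper class).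
WHAT THIS IS NOT: nothing here proves superconductivity in the Hubbard model; an input lemma of ONE conditional reduction (rung 19089).
Tree imports only; no new definitions; no sorry, no axioms.
-/

set_option linter.dupNamespace false
set_option autoImplicit false

noncomputable section

open scoped BigOperators
open Real Finset

namespace Summit.HubbardSuperconductivity.HubbardSuperconductivity.Theorems.AnisotropyChord.Transfer.Fibre3

namespace CapacityConst

variable (L : ℕ) [NeZero L]

/-! ## ★ The Bose sum -/

omit [NeZero L] in
/-- one term of the Bose sum, `p ≤ L/2` side, crude: `b_p ψ₀(u_p)/L ≤ (1/6)·(e^{−7/2})^p` for `3 ≤ p`, `2p ≤ L`. [folklore] -/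
theorem bose_term_crude (p : ℕ) (hp : 3 ≤ p) (h2 : 2 * p ≤ L) :
    2 / (Real.exp (L * RateLemma.rowMu L p) - 1) * psiRow 0 (2 * Real.pi * p / L) / L
      ≤ (1 / 6) * Real.exp (-(7 / 2 : ℝ)) ^ p := by
  have hp0 : 0 < p := by omega
  have hb := bose_le_of L p (t := (7 / 2 : ℝ) * p) (by positivity) (L_mul_rowMu_ge L p hp0 h2)
  have hψ := psiRow_row_div_le L p hp0 h2
  have hψ0 : 0 ≤ psiRow 0 (2 * Real.pi * p / L) / L := by
    have hs := sin_row_pos L p hp0 (by omega)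
    have h := psiRow_zero_eq (2 * Real.pi * p / L)
      (by rw [show 2 * Real.pi * (p : ℝ) / L / 2 = Real.pi * p / L by ring]; exact hs.le)
    rw [h]
    have : 0 ≤ Real.sin (2 * Real.pi * ↑p / ↑L / 2) := by
      rw [show 2 * Real.pi * (p : ℝ) / L / 2 = Real.pi * p / L by ring]; exact hs.le
    positivity
  -- `2/(e^{3.5p} − 1) ≤ 4 e^{−3.5 p}` since `e^{3.5p} ≥ 2`
  have hE : Real.exp ((7 / 2 : ℝ) * p) = (Real.exp (-(7 / 2 : ℝ)) ^ p)⁻¹ := by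
    rw [← Real.exp_nat_mul, ← Real.exp_neg]; congr 1; ring
  set r := Real.exp (-(7 / 2 : ℝ)) with hr
  have hr0 : 0 < r := Real.exp_pos _
  have hrp : 0 < r ^ p := pow_pos hr0 p
  have hr1 : r ≤ 1 / 30 := exp_neg_ge
  have hrp_small : r ^ p ≤ 1 / 2 := by
    have : r ^ p ≤ r ^ 1 := pow_le_pow_of_le_one hr0.le (by linarith) (by omega)
    linarith [pow_one r]
  have hb2 : 2 / (Real.exp (L * RateLemma.rowMu L p) - 1) ≤ 4 * r ^ p := by
    refine hb.trans ?_
    rw [hE, div_le_iff₀ (by rw [inv_eq_one_div, lt_sub_iff_add_lt, zero_add, lt_div_iff₀ hrp]; linarith)]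
    rw [inv_eq_one_div]
    have : 4 * r ^ p * (1 / r ^ p - 1) = 4 - 4 * r ^ p := by field_simp
    rw [this]; linarith
  have hb0 : 0 ≤ 2 / (Real.exp (L * RateLemma.rowMu L p) - 1) := bose_nonneg L p hp0 (by omega)
  have hp3 : (3 : ℝ) ≤ p := by exact_mod_cast hp
  calc 2 / (Real.exp (L * RateLemma.rowMu L p) - 1) * psiRow 0 (2 * Real.pi * p / L) / L
      = 2 / (Real.exp (L * RateLemma.rowMu L p) - 1) * (psiRow 0 (2 * Real.pi * p / L) / L) := by ring
    _ ≤ (4 * r ^ p) * (1 / (8 * p)) := mul_le_mul hb2 hψ hψ0 (by positivity)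
    _ ≤ (1 / 6) * r ^ p := by
        rw [show 4 * r ^ p * (1 / (8 * (p : ℝ))) = r ^ p * (1 / (2 * p)) by ring]
        have : 1 / (2 * (p : ℝ)) ≤ 1 / 6 := by
          rw [div_le_div_iff₀ (by positivity) (by norm_num)]; linarith
        nlinarith

/-- the first row, sharp: `b_1 ψ₀(u_1)/L ≤ 0.00032` for `L ≥ 64`. [folklore] -/
theorem bose_term_one (hL : 64 ≤ L) :
    2 / (Real.exp (L * RateLemma.rowMu L 1) - 1) * psiRow 0 (2 * Real.pi * (1 : ℕ) / L) / L ≤ 0.00032 := by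
  have hL0 : (0 : ℝ) < L := by exact_mod_cast (show 0 < L by omega)
  have hL64 : (64 : ℝ) ≤ L := by exact_mod_cast hL
  have hπL : Real.pi * (1 : ℕ) ≤ (L : ℝ) := by simp; linarith [Real.pi_lt_d2]
  have hx2 : (Real.pi * (1 : ℕ) / L) ^ 2 ≤ 0.0025 := by
    rw [Nat.cast_one, mul_one, div_pow, div_le_iff₀ (by positivity)]
    nlinarith [Real.pi_lt_d2, Real.pi_pos]
  -- `Lμ₁ ≥ 2π(1 − x²/3) ≥ 6.25`
  have hμ := L_mul_rowMu_ge_sharp L 1 one_pos hπL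
  simp only [Nat.cast_one, mul_one] at hμ hx2
  have ht : (25 / 4 : ℝ) ≤ L * RateLemma.rowMu L 1 := by
    refine le_trans ?_ hμ
    have h1 : 1 - 0.0025 / 3 ≤ 1 - (Real.pi / L) ^ 2 / 3 := by linarith
    have h2 : 2 * Real.pi * (1 - 0.0025 / 3) ≤ 2 * Real.pi * (1 - (Real.pi / L) ^ 2 / 3) :=
      mul_le_mul_of_nonneg_left h1 (by positivity)
    nlinarith [Real.pi_gt_d2]
  have hb := bose_le_of L 1 (by norm_num) ht
  have hb' : 2 / (Real.exp (L * RateLemma.rowMu L 1) - 1) ≤ 2 / 499 := by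
    refine hb.trans ?_
    apply div_le_div_of_nonneg_left (by norm_num) (by norm_num)
    linarith [exp_quarter_ge]
  have hψ := psiRow_row_div_le_sharp L 1 one_pos hπL
  simp only [Nat.cast_one, mul_one] at hψ
  have hψ' : psiRow 0 (2 * Real.pi / L) / L ≤ 0.0798 := by
    refine hψ.trans ?_
    have h1 : 1 - 0.0025 / 6 ≤ 1 - (Real.pi / L) ^ 2 / 6 := by linarith
    have h2 : 4 * 3.141592 * (1 - 0.0025 / 6) ≤ 4 * Real.pi * (1 - (Real.pi / L) ^ 2 / 6) :=
      mul_le_mul (by nlinarith [Real.pi_gt_d6]) h1 (by norm_num) (by positivity)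
    have hpos : 0 < 4 * Real.pi * (1 - (Real.pi / L) ^ 2 / 6) := lt_of_lt_of_le (by norm_num) h2
    rw [div_le_iff₀ hpos]
    nlinarith
  have hψ0 : 0 ≤ psiRow 0 (2 * Real.pi / L) / L := by
    have hs := sin_row_pos L 1 one_pos (by omega)
    simp only [Nat.cast_one, mul_one] at hs
    have h := psiRow_zero_eq (2 * Real.pi / L)
      (by rw [show 2 * Real.pi / L / 2 = Real.pi / L by ring]; exact hs.le)
    rw [h]
    have : 0 ≤ Real.sin (2 * Real.pi / ↑L / 2) := by
      rw [show 2 * Real.pi / L / 2 = Real.pi / L by ring]; exact hs.le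
    positivity
  have hb0 : 0 ≤ 2 / (Real.exp (L * RateLemma.rowMu L 1) - 1) := bose_nonneg L 1 one_pos (by omega)
  simp only [Nat.cast_one, mul_one]
  calc 2 / (Real.exp (L * RateLemma.rowMu L 1) - 1) * psiRow 0 (2 * Real.pi / L) / L
      = 2 / (Real.exp (L * RateLemma.rowMu L 1) - 1) * (psiRow 0 (2 * Real.pi / L) / L) := by ring
    _ ≤ (2 / 499) * 0.0798 := mul_le_mul hb' hψ' hψ0 (by norm_num)
    _ ≤ 0.00032 := by norm_num

/-- the second row: `b_2 ψ₀(u_2)/L ≤ 10⁻⁶` for `L ≥ 64`. [folklore] -/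
theorem bose_term_two (hL : 64 ≤ L) :
    2 / (Real.exp (L * RateLemma.rowMu L 2) - 1) * psiRow 0 (2 * Real.pi * (2 : ℕ) / L) / L ≤ 0.000001 := by
  have hL0 : (0 : ℝ) < L := by exact_mod_cast (show 0 < L by omega)
  have hL64 : (64 : ℝ) ≤ L := by exact_mod_cast hL
  have hπL : Real.pi * (2 : ℕ) ≤ (L : ℝ) := by push_cast; linarith [Real.pi_lt_d2]
  have hx2 : (Real.pi * (2 : ℕ) / L) ^ 2 ≤ 0.01 := by
    push_cast
    rw [div_pow, div_le_iff₀ (by positivity)]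
    nlinarith [Real.pi_lt_d2, Real.pi_pos]
  have hμ := L_mul_rowMu_ge_sharp L 2 (by norm_num) hπL
  have ht : (12 : ℝ) ≤ L * RateLemma.rowMu L 2 := by
    refine le_trans ?_ hμ
    push_cast at hx2 ⊢
    nlinarith [Real.pi_gt_d2, hx2]
  have hb := bose_le_of L 2 (by norm_num) ht
  have hb' : 2 / (Real.exp (L * RateLemma.rowMu L 2) - 1) ≤ 2 / 159999 := by
    refine hb.trans ?_
    apply div_le_div_of_nonneg_left (by norm_num) (by norm_num)
    linarith [exp_twelve_ge]
  have hψ := psiRow_row_div_le L 2 (by norm_num) (by omega)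
  have hψ0 : 0 ≤ psiRow 0 (2 * Real.pi * (2 : ℕ) / L) / L := by
    have hs := sin_row_pos L 2 (by norm_num) (by omega)
    have h := psiRow_zero_eq (2 * Real.pi * (2 : ℕ) / L)
      (by rw [show 2 * Real.pi * ((2 : ℕ) : ℝ) / L / 2 = Real.pi * (2 : ℕ) / L by ring]; exact hs.le)
    rw [h]
    have : 0 ≤ Real.sin (2 * Real.pi * ((2 : ℕ) : ℝ) / ↑L / 2) := by
      rw [show 2 * Real.pi * ((2 : ℕ) : ℝ) / L / 2 = Real.pi * (2 : ℕ) / L by ring]; exact hs.le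
    positivity
  have hb0 : 0 ≤ 2 / (Real.exp (L * RateLemma.rowMu L 2) - 1) := bose_nonneg L 2 (by norm_num) (by omega)
  calc 2 / (Real.exp (L * RateLemma.rowMu L 2) - 1) * psiRow 0 (2 * Real.pi * (2 : ℕ) / L) / L
      = 2 / (Real.exp (L * RateLemma.rowMu L 2) - 1) * (psiRow 0 (2 * Real.pi * (2 : ℕ) / L) / L) := by ring
    _ ≤ (2 / 159999) * (1 / (8 * (2 : ℕ))) := mul_le_mul hb' hψ hψ0 (by norm_num)
    _ ≤ 0.000001 := by norm_num

/-! ## ★ The Bose sum -/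

omit [NeZero L] in
/-- reflection of a sum over `Ico 1 L`. [folklore] -/
theorem sum_Ico_one_reflect (f : ℕ → ℝ) :
    ∑ p ∈ Finset.Ico 1 L, f (L - p) = ∑ p ∈ Finset.Ico 1 L, f p := by
  apply Finset.sum_nbij' (fun p => L - p) (fun p => L - p)
  · intro p hp; simp only [Finset.mem_Ico] at hp ⊢; omega
  · intro p hp; simp only [Finset.mem_Ico] at hp ⊢; omega
  · intro p hp; simp only [Finset.mem_Ico] at hp; omega
  · intro p hp; simp only [Finset.mem_Ico] at hp; omega
  · intro p hp; rfl

/-- ★ THE BOSE SUM: `0 ≤ (1/L)Σ_{p=1}^{L−1} b_p ψ₀(2πp/L) ≤ 0.0007` for `L ≥ 64`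
(`b_p = 2/(e^{Lμ_p} − 1)`; truth `→ Σ_m 1/(πm(e^{2πm} − 1)) = 5.97·10⁻⁴`). [folklore] -/
theorem bose_sum_bounds (hL : 64 ≤ L) :
    0 ≤ (∑ p ∈ (Finset.range L).erase 0,
        2 / (Real.exp (L * RateLemma.rowMu L p) - 1) * psiRow 0 (2 * Real.pi * p / L)) / L ∧
    (∑ p ∈ (Finset.range L).erase 0,
        2 / (Real.exp (L * RateLemma.rowMu L p) - 1) * psiRow 0 (2 * Real.pi * p / L)) / L ≤ 0.0007 := by
  have hL0 : (0 : ℝ) < L := by exact_mod_cast (show 0 < L by omega)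
  set t : ℕ → ℝ := fun p =>
    2 / (Real.exp (L * RateLemma.rowMu L p) - 1) * psiRow 0 (2 * Real.pi * p / L) / L with htdef
  have hsum : (∑ p ∈ (Finset.range L).erase 0,
        2 / (Real.exp (L * RateLemma.rowMu L p) - 1) * psiRow 0 (2 * Real.pi * p / L)) / L
      = ∑ p ∈ Finset.Ico 1 L, t p := by
    rw [Finset.range_eq_Ico, ← Nat.Ico_succ_left_eq_erase_Ico, Finset.sum_div]
  rw [hsum]
  -- nonnegativity of the terms
  have ht0 : ∀ p ∈ Finset.Ico 1 L, 0 ≤ t p := by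
    intro p hp
    rw [Finset.mem_Ico] at hp
    have hs := sin_row_pos L p (by omega) hp.2
    have hψ := psiRow_zero_eq (2 * Real.pi * p / L)
      (by rw [show 2 * Real.pi * (p : ℝ) / L / 2 = Real.pi * p / L by ring]; exact hs.le)
    have hb := bose_nonneg L p (by omega) hp.2
    simp only [htdef]
    rw [hψ, show 2 * Real.pi * (p : ℝ) / L / 2 = Real.pi * p / L by ring]
    positivity
  refine ⟨Finset.sum_nonneg ht0, ?_⟩
  -- the majorant profile
  set r : ℝ := Real.exp (-(7 / 2 : ℝ)) with hr
  have hr0 : 0 < r := Real.exp_pos _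
  have hr1 : r ≤ 1 / 30 := exp_neg_ge
  set h : ℕ → ℝ := fun q => if q = 1 then 0.00032 else if q = 2 then 0.000001 else (1 / 6) * r ^ q with hhdef
  have hh0 : ∀ q, 0 ≤ h q := by
    intro q
    simp only [hhdef]
    split_ifs <;> positivity
  -- termwise domination `t p ≤ h p + h (L − p)`
  have hrefl_t : ∀ p, p ≤ L → t (L - p) = t p := by
    intro p hp
    simp only [htdef]
    rw [rowMu_reflect L p hp, psiRow_row_reflect L p hp]
  have hdom : ∀ p ∈ Finset.Ico 1 L, t p ≤ h p + h (L - p) := by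
    intro p hp
    rw [Finset.mem_Ico] at hp
    have hA := hh0 p
    have hB := hh0 (L - p)
    by_cases h1 : p = 1
    · subst h1
      have := bose_term_one L hL
      have e : h 1 = 0.00032 := by simp [hhdef]
      simp only [htdef] at this ⊢
      linarith [e]
    by_cases h2 : p = 2
    · subst h2
      have := bose_term_two L hL
      have e : h 2 = 0.000001 := by simp [hhdef]
      simp only [htdef] at this ⊢
      linarith [e]
    by_cases h3 : p = L - 1
    · have e1 : L - p = 1 := by omega
      have := bose_term_one L hL
      have e : h 1 = 0.00032 := by simp [hhdef]
      rw [← hrefl_t p (by omega), e1]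
      simp only [htdef] at this ⊢
      linarith [e]
    by_cases h4 : p = L - 2
    · have e1 : L - p = 2 := by omega
      have := bose_term_two L hL
      have e : h 2 = 0.000001 := by simp [hhdef]
      rw [← hrefl_t p (by omega), e1]
      simp only [htdef] at this ⊢
      linarith [e]
    -- generic rows: `3 ≤ p ≤ L − 3`
    by_cases h5 : 2 * p ≤ L
    · have := bose_term_crude L p (by omega) h5
      have e : h p = (1 / 6) * r ^ p := by simp [hhdef, h1, h2]
      simp only [htdef] at this ⊢
      linarith [e]
    · have hq : 2 * (L - p) ≤ L := by omega
      have := bose_term_crude L (L - p) (by omega) hq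
      have hne1 : L - p ≠ 1 := by omega
      have hne2 : L - p ≠ 2 := by omega
      have e : h (L - p) = (1 / 6) * r ^ (L - p) := by simp [hhdef, hne1, hne2]
      rw [← hrefl_t p (by omega)]
      simp only [htdef] at this ⊢
      linarith [e]
  -- sum the majorant
  have hS : ∑ p ∈ Finset.Ico 1 L, t p ≤ 2 * ∑ p ∈ Finset.Ico 1 L, h p := by
    calc ∑ p ∈ Finset.Ico 1 L, t p ≤ ∑ p ∈ Finset.Ico 1 L, (h p + h (L - p)) := Finset.sum_le_sum hdom
      _ = ∑ p ∈ Finset.Ico 1 L, h p + ∑ p ∈ Finset.Ico 1 L, h (L - p) := Finset.sum_add_distrib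
      _ = 2 * ∑ p ∈ Finset.Ico 1 L, h p := by rw [sum_Ico_one_reflect L h]; ring
  have hH : ∑ p ∈ Finset.Ico 1 L, h p ≤ 0.00035 := by
    rw [Finset.sum_eq_sum_Ico_succ_bot (show 1 < L by omega),
      Finset.sum_eq_sum_Ico_succ_bot (show 2 < L by omega)]
    have e1 : h 1 = 0.00032 := by simp [hhdef]
    have e2 : h 2 = 0.000001 := by simp [hhdef]
    have e3 : ∑ p ∈ Finset.Ico 3 L, h p = (1 / 6) * ∑ p ∈ Finset.Ico 3 L, r ^ p := by
      rw [Finset.mul_sum]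
      refine Finset.sum_congr rfl (fun p hp => ?_)
      rw [Finset.mem_Ico] at hp
      have hne1 : p ≠ 1 := by omega
      have hne2 : p ≠ 2 := by omega
      simp [hhdef, hne1, hne2]
    have hgeom : ∑ p ∈ Finset.Ico 3 L, r ^ p ≤ r ^ 3 / (1 - r) :=
      geom_sum_Ico_le_of_lt_one hr0.le (by linarith)
    have htail : r ^ 3 / (1 - r) ≤ 0.0001 := by
      rw [div_le_iff₀ (by linarith)]
      have : r ^ 3 ≤ (1 / 30) ^ 3 := pow_le_pow_left₀ hr0.le hr1 3
      nlinarith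
    rw [e1, e2, e3]
    linarith
  linarith

end CapacityConst

end Summit.HubbardSuperconductivity.HubbardSuperconductivity.Theorems.AnisotropyChord.Transfer.Fibre3

end
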